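import Summits.BirchSwinnertonDyer.Rank1Residual.P2.KrizLiSmallCMBase
import Summits.BirchSwinnertonDyer.Rank1Residual.P2.KrizLiSeventeenTwentyEight
import HarnessLib

/-!
# Cell `bsd-print-cf2` (D-0131 (2) PRINT TIER, leaf CornerF @ `p = 2`), typer ty2 — the (★)-CERTIFIED
# bases `972d1`, `3888s1`, `1728a1`, `1728v1` (ADDITIVE at `2`) as MEMBERS of the generic Kriz–Li family
# `P2.IsIsogenousToKrizLiTwistOfSmallCMBase` (prover p3), the (★)-datum DISPLAYED as `P2.HasKrizLiStarDatum`

HONEST FRAMING. Glue (ty2) between the per-base SETTINGS `P2/KrizLiNineSeventyTwo.lean`,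
`P2/KrizLiSeventeenTwentyEight.lean` (+ the generic at-`2` package `P2/KrizLiMordellAtTwo.lean`) and prover
p3's base- and field-generic Kriz–Li door `P2/KrizLiSmallCMBase{Transport,}.lean` (`BSD(W′, 2)` BY NAME for
every globally minimal MEMBER `W′`, seven facts, NO table fact; aside stmt-BirchSwinnertonDyer-21366).
For each of the four INERT-BAD bases typed by this seat, ONE TERM builds the membership
`IsIsogenousToKrizLiTwistOfSmallCMBase W′` from: an imaginary quadratic `K` with `d_K ≡ 1 (mod 8)` and
`(d_K/3) = 1` (the primes `2`, `3` of `N` split), the DISPLAYED (★)-datum `hSD : HasKrizLiStarDatum curveX K`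
— which for a base ADDITIVE at `2` INCLUDES Kriz–Li's Manin clause "`Dt.c` odd" for the displayed
parametrisation (a CERTIFICATE, cell dossier §14.4/§14.8; for Cremona's optimal `Dt` it is also the
tree's Agashe–Ribet–Stein facts `cremona_optimal_curveOne_krizLiJZero` / `exists_optimal_odd_maninConstant_of_mem_krizLiJZero`,
not consumed here) —, `d ∈ 𝒩(E, K)` (also from explicit decidable data), `d > 0`, `d ≡ 1 (mod 12)`
(the kernel's sign clause: `N = 3ᵏ·2^{f₂}`, `f₂ ∈ {2, 4, 6}` even), and a `ℚ`-isogeny `W′ ~ E^{(d)}` or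
`E^{(d·d_K)}`; CM, `N < 5000`, `1 ≤ rank`, `E(ℚ)[2] = 0`, **`c₂` odd (Tate's algorithm in the tree)** and
the Heegner hypothesis are discharged in the kernel by the setting files. Also the specialisations to the
certified discriminant `d_K = −23`. No named fact; nothing asserted; the leaf is OPEN AS A CLASS; beyond
print: NO.

References: [KrizLi2019] Thm 5.1 (2) = arXiv:1606.03172 Thm 1.12, Def 4.1, §6 Ex. 6.2, Rem. 6.3;
[SilvermanATAEC1994] IV.9.4, Table 4.1; [Cremona1997] Table 1 (972d1, 1728a1, 1728v1, 3888s1); cell dossier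
§14.4, §14.6, §14.8.
-/

noncomputable section

open scoped Classical

open WeierstrassCurve NumberField Literature.NumberTheory.EllipticCurves
  Literature.NumberTheory.EllipticCurves.Rank1Residual
  Literature.NumberTheory.EllipticCurves.ModularForms
  Summit.BirchSwinnertonDyer.Rank1Residual

set_option autoImplicit false

namespace Summit.BirchSwinnertonDyer.Rank1Residual.P2

/-! ### `972d1` (`y² = x³ + 36`, additive at `2`; certified field `ℚ(√−23)`) -/

/-- `972d1` has CM (`j = 0`). [cite: SilvermanAEC2009, Appendix C §11] -/
theorem hasCM_curve972d1 : curve972d1.HasCM :=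
  hasCM_of_j_eq_zero _ (CornerFTwo.Atlas.j_eq_zero_of_smul_sextic (B := 36) (by norm_num)
    (C := (1 : VariableChange ℚ)) (one_smul _ _))

/-- **The Kriz–Li classes of `972d1` are MEMBERS of the generic family** — in ANY imaginary quadratic `K`
with `d_K ≡ 1 (mod 8)` and `(d_K/3) = 1` carrying a (★)-datum `hSD : HasKrizLiStarDatum curve972d1 K` (the
DISPLAYED certificate, INCLUDING the Manin clause "`Dt.c` odd" since `E` is additive at `2`), for
`d ∈ 𝒩(E, K)`, `d > 0`, `d ≡ 1 (mod 12)`: every `W'` `ℚ`-isogenous to `E^{(d)}` or `E^{(d·d_K)}`; `c₂` odd and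
everything else about the base is discharged in the kernel (`KrizLiMordellAtTwo`, base file).
[cite: KrizLi2019, Thm. 5.1 (2), Def. 4.1, §6 Ex. 6.2] -/
theorem isIsogenousToKrizLiTwistOfSmallCMBase_of_curve972d1 {K : Type} [Field K] [NumberField K]
    (hK : IsImaginaryQuadratic K) (h8 : NumberField.discr K % 8 = 1)
    (h3 : jacobiSym (NumberField.discr K) 3 = 1) (hSD : HasKrizLiStarDatum curve972d1 K)
    {d : ℤ} (hd : KrizLi2019.InN curve972d1 K d) (hd0 : 0 < d) (hd12 : d % 12 = 1)
    {W' : WeierstrassCurve ℚ}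
    (hiso : IsIsogenous W' (curve972d1.quadraticTwist (d : ℚ)) ∨
      IsIsogenous W' (curve972d1.quadraticTwist ((d * NumberField.discr K : ℤ) : ℚ))) :
    IsIsogenousToKrizLiTwistOfSmallCMBase W' := by
  haveI : Fact (2 : ℕ).Prime := ⟨Nat.prime_two⟩
  exact ⟨curve972d1, inferInstance, inferInstance, inferInstance, hasCM_curve972d1,
    conductorNorm_curve972d1_lt, one_le_mordellWeilRank_curve972d1, twoTorsion_curve972d1,
    at_two_curve972d1.2.1, K, inferInstance, inferInstance, hK,
    satisfiesHeegnerHypothesis_curve972d1 hK.1 h8 h3, hSD, d, hd,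
    sign_mul_jacobiSym_conductorNorm_curve972d1 hd0 hd12, hiso⟩

/-- **No curve `ℚ`-isogenous to a twist `972d1^{(d)}`, `d ≡ 1 (mod 4)`, is good at `2`** (isogeny
invariance of good reduction): the Kriz–Li classes of `972d1` lie in the INERT-BAD cell of crux
`InertJZeroOfFacts`; and every such curve has CM. [cite: SilvermanAEC2009, Cor. VII.7.2 and VII.5 Prop. 5.1] -/
theorem hasCM_and_not_good_two_of_isIsogenous_twist_curve972d1 {d : ℤ} (hd4 : d % 4 = 1)
    {W : WeierstrassCurve ℚ} [W.IsElliptic] (h : IsIsogenous W (curve972d1.quadraticTwist (d : ℚ))) :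
    W.HasCM ∧ ¬ Good W 2 := by
  have hd0 : (d : ℚ) ≠ 0 := by exact_mod_cast (show d ≠ 0 by omega)
  haveI := curve972d1.isElliptic_quadraticTwist hd0
  refine ⟨hasCM_of_isIsogenous_twist_of_hasCM curve972d1 hasCM_curve972d1 hd0 W h, fun hg => ?_⟩
  exact (placement_of_smul_twist_curve972d1 hd4 (C := (1 : VariableChange ℚ)) (one_smul _ _)).2.2
    ((h.hasGoodReductionAtPrime_iff 2).1 hg)

/-- **`d ∈ 𝒩(972d1, K)` from EXPLICIT, DECIDABLE data on the prime factors of `d`**: `d ≡ 1 (mod 4)`,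
`|d|` square-free, every prime `ℓ ∣ d` has `ℓ ∉ {2, 3}`, `(d_K/ℓ) = 1` and an even number of cube roots of
`-36` in `𝔽_ℓ`. [cite: KrizLi2019, Def. 4.1 (FMS) = arXiv Def. 3.1] -/
theorem inN_curve972d1_of_explicit {K : Type} [Field K] [NumberField K] (h2 : Module.finrank ℚ K = 2)
    {d : ℤ} (hd4 : d % 4 = 1) (hsq : Squarefree d.natAbs)
    (hprimes : ∀ (ℓ : ℕ) (hℓ : ℓ.Prime), ℓ ∣ d.natAbs → haveI : NeZero ℓ := ⟨hℓ.ne_zero⟩;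
      ℓ ≠ 2 ∧ ℓ ≠ 3 ∧ jacobiSym (NumberField.discr K) ℓ = 1 ∧
      Even ((Finset.univ.filter fun x : ZMod ℓ => x ^ 3 = -36).card)) :
    KrizLi2019.InN curve972d1 K d := by
  refine inN_of_explicit (S := fun ℓ => ∃ hℓ : ℓ.Prime, haveI : NeZero ℓ := ⟨hℓ.ne_zero⟩;
      ℓ ≠ 2 ∧ ℓ ≠ 3 ∧ jacobiSym (NumberField.discr K) ℓ = 1 ∧
      Even ((Finset.univ.filter fun x : ZMod ℓ => x ^ 3 = -36).card))
    (fun ℓ ⟨hℓ, h⟩ => ?_) hd4 hsq (fun ℓ hℓ hℓd => ⟨hℓ, hprimes ℓ hℓ hℓd⟩)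
  haveI : NeZero ℓ := ⟨hℓ.ne_zero⟩
  obtain ⟨hℓ2, hℓ3, hj, hev⟩ := h
  exact inS_of_explicit h2 hℓ hℓ2 (not_dvd_two_mul_conductorNorm_curve972d1 hℓ hℓ2 hℓ3) hj
    ((odd_frobeniusTrace_curve972d1_iff hℓ hℓ2 hℓ3).mpr hev)

/-- **Membership at the CERTIFIED field `K`, `d_K = −23`.** [cite: KrizLi2019, Thm. 5.1 (2) and §6 Ex. 6.2] -/
theorem isIsogenousToKrizLiTwistOfSmallCMBase_of_curve972d1_of_discr_eq {K : Type} [Field K]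
    [NumberField K] (hK : IsImaginaryQuadratic K) (hdK : NumberField.discr K = -23)
    (hSD : HasKrizLiStarDatum curve972d1 K) {d : ℤ} (hd : KrizLi2019.InN curve972d1 K d) (hd0 : 0 < d)
    (hd12 : d % 12 = 1) {W' : WeierstrassCurve ℚ}
    (hiso : IsIsogenous W' (curve972d1.quadraticTwist (d : ℚ)) ∨
      IsIsogenous W' (curve972d1.quadraticTwist ((-23 * d : ℤ) : ℚ))) :
    IsIsogenousToKrizLiTwistOfSmallCMBase W' := by
  refine isIsogenousToKrizLiTwistOfSmallCMBase_of_curve972d1 hK (by rw [hdK]; decide)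
    (by rw [hdK]; norm_num) hSD hd hd0 hd12 ?_
  rw [hdK, mul_comm]
  exact hiso

/-! ### `3888s1` (`y² = x³ + 48`, additive at `2`; certified field `ℚ(√−23)`) -/

/-- `3888s1` has CM (`j = 0`). [cite: SilvermanAEC2009, Appendix C §11] -/
theorem hasCM_curve3888s1 : curve3888s1.HasCM :=
  hasCM_of_j_eq_zero _ (CornerFTwo.Atlas.j_eq_zero_of_smul_sextic (B := 48) (by norm_num)
    (C := (1 : VariableChange ℚ)) (one_smul _ _))

/-- **The Kriz–Li classes of `3888s1` are MEMBERS of the generic family** — in ANY imaginary quadratic `K`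
with `d_K ≡ 1 (mod 8)` and `(d_K/3) = 1` carrying a (★)-datum `hSD : HasKrizLiStarDatum curve3888s1 K` (the
DISPLAYED certificate, INCLUDING the Manin clause "`Dt.c` odd" since `E` is additive at `2`), for
`d ∈ 𝒩(E, K)`, `d > 0`, `d ≡ 1 (mod 12)`: every `W'` `ℚ`-isogenous to `E^{(d)}` or `E^{(d·d_K)}`; `c₂` odd and
everything else about the base is discharged in the kernel (`KrizLiMordellAtTwo`, base file).
[cite: KrizLi2019, Thm. 5.1 (2), Def. 4.1, §6 Ex. 6.2] -/
theorem isIsogenousToKrizLiTwistOfSmallCMBase_of_curve3888s1 {K : Type} [Field K] [NumberField K]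
    (hK : IsImaginaryQuadratic K) (h8 : NumberField.discr K % 8 = 1)
    (h3 : jacobiSym (NumberField.discr K) 3 = 1) (hSD : HasKrizLiStarDatum curve3888s1 K)
    {d : ℤ} (hd : KrizLi2019.InN curve3888s1 K d) (hd0 : 0 < d) (hd12 : d % 12 = 1)
    {W' : WeierstrassCurve ℚ}
    (hiso : IsIsogenous W' (curve3888s1.quadraticTwist (d : ℚ)) ∨
      IsIsogenous W' (curve3888s1.quadraticTwist ((d * NumberField.discr K : ℤ) : ℚ))) :
    IsIsogenousToKrizLiTwistOfSmallCMBase W' := by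
  haveI : Fact (2 : ℕ).Prime := ⟨Nat.prime_two⟩
  exact ⟨curve3888s1, inferInstance, inferInstance, inferInstance, hasCM_curve3888s1,
    conductorNorm_curve3888s1_lt, one_le_mordellWeilRank_curve3888s1, twoTorsion_curve3888s1,
    at_two_curve3888s1.2.1, K, inferInstance, inferInstance, hK,
    satisfiesHeegnerHypothesis_curve3888s1 hK.1 h8 h3, hSD, d, hd,
    sign_mul_jacobiSym_conductorNorm_curve3888s1 hd0 hd12, hiso⟩

/-- **No curve `ℚ`-isogenous to a twist `3888s1^{(d)}`, `d ≡ 1 (mod 4)`, is good at `2`** (isogeny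
invariance of good reduction): the Kriz–Li classes of `3888s1` lie in the INERT-BAD cell of crux
`InertJZeroOfFacts`; and every such curve has CM. [cite: SilvermanAEC2009, Cor. VII.7.2 and VII.5 Prop. 5.1] -/
theorem hasCM_and_not_good_two_of_isIsogenous_twist_curve3888s1 {d : ℤ} (hd4 : d % 4 = 1)
    {W : WeierstrassCurve ℚ} [W.IsElliptic] (h : IsIsogenous W (curve3888s1.quadraticTwist (d : ℚ))) :
    W.HasCM ∧ ¬ Good W 2 := by
  have hd0 : (d : ℚ) ≠ 0 := by exact_mod_cast (show d ≠ 0 by omega)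
  haveI := curve3888s1.isElliptic_quadraticTwist hd0
  refine ⟨hasCM_of_isIsogenous_twist_of_hasCM curve3888s1 hasCM_curve3888s1 hd0 W h, fun hg => ?_⟩
  exact (placement_of_smul_twist_curve3888s1 hd4 (C := (1 : VariableChange ℚ)) (one_smul _ _)).2.2
    ((h.hasGoodReductionAtPrime_iff 2).1 hg)

/-- **`d ∈ 𝒩(3888s1, K)` from EXPLICIT, DECIDABLE data on the prime factors of `d`**: `d ≡ 1 (mod 4)`,
`|d|` square-free, every prime `ℓ ∣ d` has `ℓ ∉ {2, 3}`, `(d_K/ℓ) = 1` and an even number of cube roots of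
`-48` in `𝔽_ℓ`. [cite: KrizLi2019, Def. 4.1 (FMS) = arXiv Def. 3.1] -/
theorem inN_curve3888s1_of_explicit {K : Type} [Field K] [NumberField K] (h2 : Module.finrank ℚ K = 2)
    {d : ℤ} (hd4 : d % 4 = 1) (hsq : Squarefree d.natAbs)
    (hprimes : ∀ (ℓ : ℕ) (hℓ : ℓ.Prime), ℓ ∣ d.natAbs → haveI : NeZero ℓ := ⟨hℓ.ne_zero⟩;
      ℓ ≠ 2 ∧ ℓ ≠ 3 ∧ jacobiSym (NumberField.discr K) ℓ = 1 ∧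
      Even ((Finset.univ.filter fun x : ZMod ℓ => x ^ 3 = -48).card)) :
    KrizLi2019.InN curve3888s1 K d := by
  refine inN_of_explicit (S := fun ℓ => ∃ hℓ : ℓ.Prime, haveI : NeZero ℓ := ⟨hℓ.ne_zero⟩;
      ℓ ≠ 2 ∧ ℓ ≠ 3 ∧ jacobiSym (NumberField.discr K) ℓ = 1 ∧
      Even ((Finset.univ.filter fun x : ZMod ℓ => x ^ 3 = -48).card))
    (fun ℓ ⟨hℓ, h⟩ => ?_) hd4 hsq (fun ℓ hℓ hℓd => ⟨hℓ, hprimes ℓ hℓ hℓd⟩)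
  haveI : NeZero ℓ := ⟨hℓ.ne_zero⟩
  obtain ⟨hℓ2, hℓ3, hj, hev⟩ := h
  exact inS_of_explicit h2 hℓ hℓ2 (not_dvd_two_mul_conductorNorm_curve3888s1 hℓ hℓ2 hℓ3) hj
    ((odd_frobeniusTrace_curve3888s1_iff hℓ hℓ2 hℓ3).mpr hev)

/-- **Membership at the CERTIFIED field `K`, `d_K = −23`.** [cite: KrizLi2019, Thm. 5.1 (2) and §6 Ex. 6.2] -/
theorem isIsogenousToKrizLiTwistOfSmallCMBase_of_curve3888s1_of_discr_eq {K : Type} [Field K]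
    [NumberField K] (hK : IsImaginaryQuadratic K) (hdK : NumberField.discr K = -23)
    (hSD : HasKrizLiStarDatum curve3888s1 K) {d : ℤ} (hd : KrizLi2019.InN curve3888s1 K d) (hd0 : 0 < d)
    (hd12 : d % 12 = 1) {W' : WeierstrassCurve ℚ}
    (hiso : IsIsogenous W' (curve3888s1.quadraticTwist (d : ℚ)) ∨
      IsIsogenous W' (curve3888s1.quadraticTwist ((-23 * d : ℤ) : ℚ))) :
    IsIsogenousToKrizLiTwistOfSmallCMBase W' := by
  refine isIsogenousToKrizLiTwistOfSmallCMBase_of_curve3888s1 hK (by rw [hdK]; decide)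
    (by rw [hdK]; norm_num) hSD hd hd0 hd12 ?_
  rw [hdK, mul_comm]
  exact hiso

/-! ### `1728a1` (`y² = x³ + 2`, additive at `2`; certified field `ℚ(√−23)`) -/

/-- `1728a1` has CM (`j = 0`). [cite: SilvermanAEC2009, Appendix C §11] -/
theorem hasCM_curve1728a1 : curve1728a1.HasCM :=
  hasCM_of_j_eq_zero _ (CornerFTwo.Atlas.j_eq_zero_of_smul_sextic (B := 2) (by norm_num)
    (C := (1 : VariableChange ℚ)) (one_smul _ _))

/-- **The Kriz–Li classes of `1728a1` are MEMBERS of the generic family** — in ANY imaginary quadratic `K`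
with `d_K ≡ 1 (mod 8)` and `(d_K/3) = 1` carrying a (★)-datum `hSD : HasKrizLiStarDatum curve1728a1 K` (the
DISPLAYED certificate, INCLUDING the Manin clause "`Dt.c` odd" since `E` is additive at `2`), for
`d ∈ 𝒩(E, K)`, `d > 0`, `d ≡ 1 (mod 12)`: every `W'` `ℚ`-isogenous to `E^{(d)}` or `E^{(d·d_K)}`; `c₂` odd and
everything else about the base is discharged in the kernel (`KrizLiMordellAtTwo`, base file).
[cite: KrizLi2019, Thm. 5.1 (2), Def. 4.1, §6 Ex. 6.2] -/
theorem isIsogenousToKrizLiTwistOfSmallCMBase_of_curve1728a1 {K : Type} [Field K] [NumberField K]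
    (hK : IsImaginaryQuadratic K) (h8 : NumberField.discr K % 8 = 1)
    (h3 : jacobiSym (NumberField.discr K) 3 = 1) (hSD : HasKrizLiStarDatum curve1728a1 K)
    {d : ℤ} (hd : KrizLi2019.InN curve1728a1 K d) (hd0 : 0 < d) (hd12 : d % 12 = 1)
    {W' : WeierstrassCurve ℚ}
    (hiso : IsIsogenous W' (curve1728a1.quadraticTwist (d : ℚ)) ∨
      IsIsogenous W' (curve1728a1.quadraticTwist ((d * NumberField.discr K : ℤ) : ℚ))) :
    IsIsogenousToKrizLiTwistOfSmallCMBase W' := by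
  haveI : Fact (2 : ℕ).Prime := ⟨Nat.prime_two⟩
  exact ⟨curve1728a1, inferInstance, inferInstance, inferInstance, hasCM_curve1728a1,
    conductorNorm_curve1728a1_lt, one_le_mordellWeilRank_curve1728a1, twoTorsion_curve1728a1,
    at_two_curve1728a1.2.1, K, inferInstance, inferInstance, hK,
    satisfiesHeegnerHypothesis_curve1728a1 hK.1 h8 h3, hSD, d, hd,
    sign_mul_jacobiSym_conductorNorm_curve1728a1 hd0 hd12, hiso⟩

/-- **No curve `ℚ`-isogenous to a twist `1728a1^{(d)}`, `d ≡ 1 (mod 4)`, is good at `2`** (isogeny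
invariance of good reduction): the Kriz–Li classes of `1728a1` lie in the INERT-BAD cell of crux
`InertJZeroOfFacts`; and every such curve has CM. [cite: SilvermanAEC2009, Cor. VII.7.2 and VII.5 Prop. 5.1] -/
theorem hasCM_and_not_good_two_of_isIsogenous_twist_curve1728a1 {d : ℤ} (hd4 : d % 4 = 1)
    {W : WeierstrassCurve ℚ} [W.IsElliptic] (h : IsIsogenous W (curve1728a1.quadraticTwist (d : ℚ))) :
    W.HasCM ∧ ¬ Good W 2 := by
  have hd0 : (d : ℚ) ≠ 0 := by exact_mod_cast (show d ≠ 0 by omega)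
  haveI := curve1728a1.isElliptic_quadraticTwist hd0
  refine ⟨hasCM_of_isIsogenous_twist_of_hasCM curve1728a1 hasCM_curve1728a1 hd0 W h, fun hg => ?_⟩
  exact (placement_of_smul_twist_curve1728a1 hd4 (C := (1 : VariableChange ℚ)) (one_smul _ _)).2.2
    ((h.hasGoodReductionAtPrime_iff 2).1 hg)

/-- **`d ∈ 𝒩(1728a1, K)` from EXPLICIT, DECIDABLE data on the prime factors of `d`**: `d ≡ 1 (mod 4)`,
`|d|` square-free, every prime `ℓ ∣ d` has `ℓ ∉ {2, 3}`, `(d_K/ℓ) = 1` and an even number of cube roots of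
`-2` in `𝔽_ℓ`. [cite: KrizLi2019, Def. 4.1 (FMS) = arXiv Def. 3.1] -/
theorem inN_curve1728a1_of_explicit {K : Type} [Field K] [NumberField K] (h2 : Module.finrank ℚ K = 2)
    {d : ℤ} (hd4 : d % 4 = 1) (hsq : Squarefree d.natAbs)
    (hprimes : ∀ (ℓ : ℕ) (hℓ : ℓ.Prime), ℓ ∣ d.natAbs → haveI : NeZero ℓ := ⟨hℓ.ne_zero⟩;
      ℓ ≠ 2 ∧ ℓ ≠ 3 ∧ jacobiSym (NumberField.discr K) ℓ = 1 ∧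
      Even ((Finset.univ.filter fun x : ZMod ℓ => x ^ 3 = -2).card)) :
    KrizLi2019.InN curve1728a1 K d := by
  refine inN_of_explicit (S := fun ℓ => ∃ hℓ : ℓ.Prime, haveI : NeZero ℓ := ⟨hℓ.ne_zero⟩;
      ℓ ≠ 2 ∧ ℓ ≠ 3 ∧ jacobiSym (NumberField.discr K) ℓ = 1 ∧
      Even ((Finset.univ.filter fun x : ZMod ℓ => x ^ 3 = -2).card))
    (fun ℓ ⟨hℓ, h⟩ => ?_) hd4 hsq (fun ℓ hℓ hℓd => ⟨hℓ, hprimes ℓ hℓ hℓd⟩)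
  haveI : NeZero ℓ := ⟨hℓ.ne_zero⟩
  obtain ⟨hℓ2, hℓ3, hj, hev⟩ := h
  exact inS_of_explicit h2 hℓ hℓ2 (not_dvd_two_mul_conductorNorm_curve1728a1 hℓ hℓ2 hℓ3) hj
    ((odd_frobeniusTrace_curve1728a1_iff hℓ hℓ2 hℓ3).mpr hev)

/-- **Membership at the CERTIFIED field `K`, `d_K = −23`.** [cite: KrizLi2019, Thm. 5.1 (2) and §6 Ex. 6.2] -/
theorem isIsogenousToKrizLiTwistOfSmallCMBase_of_curve1728a1_of_discr_eq {K : Type} [Field K]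
    [NumberField K] (hK : IsImaginaryQuadratic K) (hdK : NumberField.discr K = -23)
    (hSD : HasKrizLiStarDatum curve1728a1 K) {d : ℤ} (hd : KrizLi2019.InN curve1728a1 K d) (hd0 : 0 < d)
    (hd12 : d % 12 = 1) {W' : WeierstrassCurve ℚ}
    (hiso : IsIsogenous W' (curve1728a1.quadraticTwist (d : ℚ)) ∨
      IsIsogenous W' (curve1728a1.quadraticTwist ((-23 * d : ℤ) : ℚ))) :
    IsIsogenousToKrizLiTwistOfSmallCMBase W' := by
  refine isIsogenousToKrizLiTwistOfSmallCMBase_of_curve1728a1 hK (by rw [hdK]; decide)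
    (by rw [hdK]; norm_num) hSD hd hd0 hd12 ?_
  rw [hdK, mul_comm]
  exact hiso

/-! ### `1728v1` (`y² = x³ + (-2)`, additive at `2`; certified field `ℚ(√−23)`) -/

/-- `1728v1` has CM (`j = 0`). [cite: SilvermanAEC2009, Appendix C §11] -/
theorem hasCM_curve1728v1 : curve1728v1.HasCM :=
  hasCM_of_j_eq_zero _ (CornerFTwo.Atlas.j_eq_zero_of_smul_sextic (B := (-2 : ℚ)) (by norm_num)
    (C := (1 : VariableChange ℚ)) (one_smul _ _))

/-- **The Kriz–Li classes of `1728v1` are MEMBERS of the generic family** — in ANY imaginary quadratic `K`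
with `d_K ≡ 1 (mod 8)` and `(d_K/3) = 1` carrying a (★)-datum `hSD : HasKrizLiStarDatum curve1728v1 K` (the
DISPLAYED certificate, INCLUDING the Manin clause "`Dt.c` odd" since `E` is additive at `2`), for
`d ∈ 𝒩(E, K)`, `d > 0`, `d ≡ 1 (mod 12)`: every `W'` `ℚ`-isogenous to `E^{(d)}` or `E^{(d·d_K)}`; `c₂` odd and
everything else about the base is discharged in the kernel (`KrizLiMordellAtTwo`, base file).
[cite: KrizLi2019, Thm. 5.1 (2), Def. 4.1, §6 Ex. 6.2] -/
theorem isIsogenousToKrizLiTwistOfSmallCMBase_of_curve1728v1 {K : Type} [Field K] [NumberField K]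
    (hK : IsImaginaryQuadratic K) (h8 : NumberField.discr K % 8 = 1)
    (h3 : jacobiSym (NumberField.discr K) 3 = 1) (hSD : HasKrizLiStarDatum curve1728v1 K)
    {d : ℤ} (hd : KrizLi2019.InN curve1728v1 K d) (hd0 : 0 < d) (hd12 : d % 12 = 1)
    {W' : WeierstrassCurve ℚ}
    (hiso : IsIsogenous W' (curve1728v1.quadraticTwist (d : ℚ)) ∨
      IsIsogenous W' (curve1728v1.quadraticTwist ((d * NumberField.discr K : ℤ) : ℚ))) :
    IsIsogenousToKrizLiTwistOfSmallCMBase W' := by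
  haveI : Fact (2 : ℕ).Prime := ⟨Nat.prime_two⟩
  exact ⟨curve1728v1, inferInstance, inferInstance, inferInstance, hasCM_curve1728v1,
    conductorNorm_curve1728v1_lt, one_le_mordellWeilRank_curve1728v1, twoTorsion_curve1728v1,
    at_two_curve1728v1.2.1, K, inferInstance, inferInstance, hK,
    satisfiesHeegnerHypothesis_curve1728v1 hK.1 h8 h3, hSD, d, hd,
    sign_mul_jacobiSym_conductorNorm_curve1728v1 hd0 hd12, hiso⟩

/-- **No curve `ℚ`-isogenous to a twist `1728v1^{(d)}`, `d ≡ 1 (mod 4)`, is good at `2`** (isogeny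
invariance of good reduction): the Kriz–Li classes of `1728v1` lie in the INERT-BAD cell of crux
`InertJZeroOfFacts`; and every such curve has CM. [cite: SilvermanAEC2009, Cor. VII.7.2 and VII.5 Prop. 5.1] -/
theorem hasCM_and_not_good_two_of_isIsogenous_twist_curve1728v1 {d : ℤ} (hd4 : d % 4 = 1)
    {W : WeierstrassCurve ℚ} [W.IsElliptic] (h : IsIsogenous W (curve1728v1.quadraticTwist (d : ℚ))) :
    W.HasCM ∧ ¬ Good W 2 := by
  have hd0 : (d : ℚ) ≠ 0 := by exact_mod_cast (show d ≠ 0 by omega)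
  haveI := curve1728v1.isElliptic_quadraticTwist hd0
  refine ⟨hasCM_of_isIsogenous_twist_of_hasCM curve1728v1 hasCM_curve1728v1 hd0 W h, fun hg => ?_⟩
  exact (placement_of_smul_twist_curve1728v1 hd4 (C := (1 : VariableChange ℚ)) (one_smul _ _)).2.2
    ((h.hasGoodReductionAtPrime_iff 2).1 hg)

/-- **`d ∈ 𝒩(1728v1, K)` from EXPLICIT, DECIDABLE data on the prime factors of `d`**: `d ≡ 1 (mod 4)`,
`|d|` square-free, every prime `ℓ ∣ d` has `ℓ ∉ {2, 3}`, `(d_K/ℓ) = 1` and an even number of cube roots of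
`2` in `𝔽_ℓ`. [cite: KrizLi2019, Def. 4.1 (FMS) = arXiv Def. 3.1] -/
theorem inN_curve1728v1_of_explicit {K : Type} [Field K] [NumberField K] (h2 : Module.finrank ℚ K = 2)
    {d : ℤ} (hd4 : d % 4 = 1) (hsq : Squarefree d.natAbs)
    (hprimes : ∀ (ℓ : ℕ) (hℓ : ℓ.Prime), ℓ ∣ d.natAbs → haveI : NeZero ℓ := ⟨hℓ.ne_zero⟩;
      ℓ ≠ 2 ∧ ℓ ≠ 3 ∧ jacobiSym (NumberField.discr K) ℓ = 1 ∧
      Even ((Finset.univ.filter fun x : ZMod ℓ => x ^ 3 = 2).card)) :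
    KrizLi2019.InN curve1728v1 K d := by
  refine inN_of_explicit (S := fun ℓ => ∃ hℓ : ℓ.Prime, haveI : NeZero ℓ := ⟨hℓ.ne_zero⟩;
      ℓ ≠ 2 ∧ ℓ ≠ 3 ∧ jacobiSym (NumberField.discr K) ℓ = 1 ∧
      Even ((Finset.univ.filter fun x : ZMod ℓ => x ^ 3 = 2).card))
    (fun ℓ ⟨hℓ, h⟩ => ?_) hd4 hsq (fun ℓ hℓ hℓd => ⟨hℓ, hprimes ℓ hℓ hℓd⟩)
  haveI : NeZero ℓ := ⟨hℓ.ne_zero⟩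
  obtain ⟨hℓ2, hℓ3, hj, hev⟩ := h
  exact inS_of_explicit h2 hℓ hℓ2 (not_dvd_two_mul_conductorNorm_curve1728v1 hℓ hℓ2 hℓ3) hj
    ((odd_frobeniusTrace_curve1728v1_iff hℓ hℓ2 hℓ3).mpr hev)

/-- **Membership at the CERTIFIED field `K`, `d_K = −23`.** [cite: KrizLi2019, Thm. 5.1 (2) and §6 Ex. 6.2] -/
theorem isIsogenousToKrizLiTwistOfSmallCMBase_of_curve1728v1_of_discr_eq {K : Type} [Field K]
    [NumberField K] (hK : IsImaginaryQuadratic K) (hdK : NumberField.discr K = -23)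
    (hSD : HasKrizLiStarDatum curve1728v1 K) {d : ℤ} (hd : KrizLi2019.InN curve1728v1 K d) (hd0 : 0 < d)
    (hd12 : d % 12 = 1) {W' : WeierstrassCurve ℚ}
    (hiso : IsIsogenous W' (curve1728v1.quadraticTwist (d : ℚ)) ∨
      IsIsogenous W' (curve1728v1.quadraticTwist ((-23 * d : ℤ) : ℚ))) :
    IsIsogenousToKrizLiTwistOfSmallCMBase W' := by
  refine isIsogenousToKrizLiTwistOfSmallCMBase_of_curve1728v1 hK (by rw [hdK]; decide)
    (by rw [hdK]; norm_num) hSD hd hd0 hd12 ?_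
  rw [hdK, mul_comm]
  exact hiso

end Summit.BirchSwinnertonDyer.Rank1Residual.P2
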